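import Summits.QuantumFields.GaugeBoot.CentralLoopEquations
import HarnessLib

/-!
# The central `U(1)` direction of `U(N)`: gauge-invariant rows are all the rows (gauge-boot, L1 supplement)

HONEST FRAMING (cell `pub-gaugeboot`, page 1 of every file): the venture produces certified bounds
on lattice expectations at stated coupling, gauge group, dimension and torus size; NOT a mass gap,
NOT a continuum limit, NOT a string tension; NOT Yang–Mills-summit-bearing (barriers
`FixedCouplingUltralocality`, `PerturbativeInvisibility`). This module is a structural statement;
it certifies no number.

## Content — the concrete instance of `isSchwingerDysonStateOn_gaugeInvariant_iff_of_central`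

The centre of `U(N)` contains the one-parameter subgroup `t ↦ e^{it}·1 = uExp N (uCentralGen N) t`
generated by `uCentralGen N = i·1 ∈ 𝔲(N)` (`uExp_uCentralGen_comm`). By
`CentralLoopEquations.isSchwingerDysonStateOn_gaugeInvariant_iff_of_central`:

* ★★ `isSchwingerDysonStateOn_gaugeInvariant_iff_uCentral` — `U(N)` lattice gauge theory on the
  torus `(ℤ/L)^d` (any gauge-invariant continuous local actions, e.g. Wilson's), gauge-invariant
  finite measure `μ`: the Schwinger–Dyson rows along the CENTRAL direction `i·1` with
  GAUGE-INVARIANT test functions are equivalent to the rows along `i·1` with ALL test functions.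

Contrast: along the TRACELESS directions the gauge-invariant rows are `0 = β·0`
(`AdInvariantSchwingerDysonRows`, lean3 gen 72), and by `integral_mul_linearShiftDeriv_eq_central`
a gauge-invariant row along any `X ∈ 𝔲(N)` equals the row along its central part `(tr X / N)·1`.
So, for a gauge-invariant state of `U(N)`, the gauge-invariant rows carry exactly the information
of the full `U(1)`-direction rows — no more, no less.

References: M. Creutz, *Quarks, gluons and lattices* (1983) Ch. 11; V. Kazakov, Z. Zheng,
arXiv:2203.11360 §2. Folklore.
-/

noncomputable section

open MeasureTheory
open Literature.MathematicalPhysics.QuantumFieldTheory (Site Edge GaugeConfig gaugeTransform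
  IsGaugeInvariant)

namespace Summit.QuantumFields.GaugeBoot

/-- The central generator `i·1 ∈ 𝔲(N)` (skew-Hermitian). [folklore] -/
def uCentralGen (N : ℕ) : UGenerator N :=
  ⟨Complex.I • (1 : Matrix (Fin N) (Fin N) ℂ), by
    rw [skewAdjoint.mem_iff, star_smul, star_one, Complex.star_def, Complex.conj_I, neg_smul]⟩

/-- `uCentralGen` as a matrix. -/
@[simp] theorem coe_uCentralGen (N : ℕ) :
    ((uCentralGen N : UGenerator N) : Matrix (Fin N) (Fin N) ℂ) = Complex.I • 1 := rfl

/-- **`e^{it}·1` is central in `U(N)`**: the one-parameter subgroup generated by `i·1` commutes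
with every unitary matrix. [folklore] -/
theorem uExp_uCentralGen_comm (N : ℕ) (t : ℝ) (g : Matrix.unitaryGroup (Fin N) ℂ) :
    g * uExp N (uCentralGen N) t = uExp N (uCentralGen N) t * g := by
  refine Subtype.ext ?_
  change (g : Matrix (Fin N) (Fin N) ℂ) * NormedSpace.exp (t • ((uCentralGen N : UGenerator N) :
      Matrix (Fin N) (Fin N) ℂ)) = NormedSpace.exp (t • ((uCentralGen N : UGenerator N) :
      Matrix (Fin N) (Fin N) ℂ)) * (g : Matrix (Fin N) (Fin N) ℂ)
  have hc : Commute (g : Matrix (Fin N) (Fin N) ℂ)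
      (t • ((uCentralGen N : UGenerator N) : Matrix (Fin N) (Fin N) ℂ)) := by
    rw [coe_uCentralGen]
    exact ((Commute.one_right _).smul_right _).smul_right _
  exact hc.exp_right.eq

variable {d L N : ℕ}

/-- ★★ **`U(N)` on the torus, gauge-invariant state: along the central direction `i·1` the rows
with GAUGE-INVARIANT test functions are equivalent to the rows with ALL test functions** (any
gauge-invariant continuous local actions `S e`, any real `β`, `μ` finite and gauge invariant).
[folklore] -/
theorem isSchwingerDysonStateOn_gaugeInvariant_iff_uCentral [NeZero L]
    {S : Edge d L → GaugeConfig d L (Matrix.unitaryGroup (Fin N) ℂ) → ℝ} {β : ℝ}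
    (hS : ∀ e, Continuous (S e))
    (hSinv : ∀ (g : Site d L → Matrix.unitaryGroup (Fin N) ℂ) (e : Edge d L)
      (U : GaugeConfig d L (Matrix.unitaryGroup (Fin N) ℂ)), S e (gaugeTransform g U) = S e U)
    (μ : Measure (GaugeConfig d L (Matrix.unitaryGroup (Fin N) ℂ))) [IsFiniteMeasure μ]
    (hμinv : ∀ g : Site d L → Matrix.unitaryGroup (Fin N) ℂ, μ.map (gaugeTransform g) = μ) :
    IsSchwingerDysonStateOn IsGaugeInvariant (fun _ : Unit => uExp N (uCentralGen N)) S β μ ↔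
      IsSchwingerDysonState (fun _ : Unit => uExp N (uCentralGen N)) S β μ :=
  isSchwingerDysonStateOn_gaugeInvariant_iff_of_central (fun _ => continuous_uExp N _)
    (fun _ => uExp_add N _) (fun _ t g => uExp_uCentralGen_comm N t g) hS hSinv μ hμinv

end Summit.QuantumFields.GaugeBoot

end
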